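import Literature.Analysis.Matrix.FiniteRangeDecompositionQuasi1DBounds
import Literature.Analysis.Matrix.FiniteRangeDecompositionPowGradient
import HarnessLib

/-!
# Finite-range decomposition with smoother pieces, VII: the scales BEYOND the temporal period

`Literature/Analysis/Matrix/`; completes the volume-uniform gradient bounds for the power-`m` pieces
`C^{(m)}_N = frdPiecePow A m N` on the abstract anisotropic three-torus (`G`, steps `e₀,e₁,e₂` of orders dividing
`L₀ = L₁ = L ≤ L₂ = M`, characters determined by the `e_i`, `|G| ≥ L²M`, translation-invariant symmetric `A ≤ 4` with
`c₀ Σ_i (2 − 2Re ψ(e_i)) ≤ σ_A(ψ)`) in the two regimes not covered by parts III (`2^N ≤ L`, three-dimensional) and VI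
(`L ≤ 2^N ≤ M`, quasi-one-dimensional):

* `offZero_shellSum_le'`, `avg_gradSymbol_frdPiecePow_le_offL_spatial`, `abs_rowDiffs_frdPiecePow_apply_le_offL_spatial`
  — differences with a SPATIAL step at ANY scale `2^N ≥ L` (no upper restriction): `≤ K₁ (L/2^N)^{2m}/L^{k+1}` (the
  spatial zero modes do not see a spatial difference, and off the zero modes only the ratio `(L/2^N)^{2m}` of the
  symbol to its value at scale `L` matters);
* `avg_gradSymbol_frdPiecePow_le_beyond_temporal`, `abs_rowDiffs_frdPiecePow_apply_le_beyond_temporal` — purely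
  temporal differences (`k ≥ 1` steps `±e₂`, `k + 2 ≤ 2m`) at scales `2^N ≥ M`:
  `≤ K₁ ((L/2^N)^{2m}/L^{k+1} + M²/((2^N)^{k+1} L²))` — beyond the temporal period every non-trivial character has
  temporal momentum `≥ 1/M`, so only the dyadic shells `2^{j+1}/2^N > 1/M` are populated and the piece is suppressed by
  `(M/2^N)²`; summed over `2^N ≥ M` this is the `O(M^{1−k}/L²)` contribution of the scales beyond `M` to temporal
  gradients (`k = 1`: `O(1/L²)`, `k = 2`: `O(1/(ML²))`).

With parts III and VI every scale `N ≥ 0` of the decomposition of the torus Green's function now carries a volume-uniform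
gradient bound (`FiniteRangeDecompositionPseudoInverse.abs_rowDiffs_pinv_le_tsum`).  All [folklore]; exponents as in
[cite: Bauerschmidt2013, (1.10)].
-/

noncomputable section

open Finset Real
open Literature.Analysis.Fourier Literature.Analysis.Fourier.TrigApprox

namespace Literature.Analysis.Matrix

variable {G : Type*} [AddCommGroup G] [Fintype G] [DecidableEq G]

section Beyond

variable {A : _root_.Matrix G G ℝ}

omit [DecidableEq G] in
/-- The off-zero-mode shells at any scale `2^N ≥ L` (variant of `offZero_shellSum_le` with the hypothesis `2^N ≤ L₂`
replaced by `L₀ ≤ L₂`): `Σ_j B^{off}_j · |G|⁻¹#{|t|_∞ < 2^{j+1}/L} ≤ 2C₁ (L/2^N)^{2m}/L^{k+1}`. [folklore] -/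
theorem offZero_shellSum_le'
    (e : Fin 3 → G) (Ls : Fin 3 → ℕ) (hL : ∀ i, Ls i ≠ 0) (he : ∀ i, Ls i • e i = 0)
    (hgen : ∀ ψ φ : AddChar G ℂ, (∀ i, ψ (e i) = φ (e i)) → ψ = φ)
    (hcard : ∏ i, (Ls i : ℝ) ≤ Fintype.card G) (hL01 : Ls 1 = Ls 0) (hLM : Ls 0 ≤ Ls 2)
    {c₀ : ℝ} (hc₀ : 0 < c₀) {m k : ℕ} (hkm : k + 2 ≤ 2 * m) (N : ℕ) (J : ℕ) :
    ∑ j ∈ Finset.range J, (2 * π * 2 ^ (j + 1) / (Ls 0 : ℝ)) ^ k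
        * (m * π ^ (2 * m + 2) / (4 * ((2 : ℝ) ^ N) ^ (2 * m))
          * (((Ls 0 : ℝ)) ^ 2 / (16 * c₀ * ((2 : ℝ) ^ j) ^ 2)) ^ (m + 1))
        * ((Fintype.card G : ℝ)⁻¹ * ((Finset.univ.filter fun ψ : AddChar G ℂ =>
            ∀ i, |addCharMomentum (Ls i) (e i) ψ| < 2 ^ (j + 1) / (Ls 0 : ℝ)).card : ℝ))
      ≤ 27 * m * (2 * π) ^ k * π ^ (2 * m + 2) * 2 ^ (k + 4) / (4 * (16 * c₀) ^ (m + 1))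
          * ((Ls 0 : ℝ) / 2 ^ N) ^ (2 * m) / (Ls 0 : ℝ) ^ (k + 1) := by
  set Lr : ℝ := (Ls 0 : ℝ) with hLr
  set T : ℝ := 2 ^ N with hT
  have hLpos : 0 < Lr := Nat.cast_pos.mpr (Nat.pos_of_ne_zero (hL 0))
  have hTpos : 0 < T := by positivity
  have hLrs : ∀ i, (0 : ℝ) < Ls i := fun i => Nat.cast_pos.mpr (Nat.pos_of_ne_zero (hL i))
  have hLle : ∀ i, Lr ≤ (Ls i : ℝ) := by
    intro i; fin_cases i
    · exact le_rfl
    · simp [hLr, hL01]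
    · rw [hLr]; exact_mod_cast hLM
  set C₁ : ℝ := 27 * m * (2 * π) ^ k * π ^ (2 * m + 2) * 2 ^ (k + 3) / (4 * (16 * c₀) ^ (m + 1)) with hC₁
  have hC₁0 : 0 ≤ C₁ := by rw [hC₁]; positivity
  have hcj : ∀ j, (Fintype.card G : ℝ)⁻¹ * ((Finset.univ.filter fun ψ : AddChar G ℂ =>
      ∀ i, |addCharMomentum (Ls i) (e i) ψ| < 2 ^ (j + 1) / Lr).card : ℝ)
        ≤ (3 * (2 ^ (j + 1) / Lr)) ^ 3 := by
    intro j
    have hρ : (0 : ℝ) < 2 ^ (j + 1) / Lr := by positivity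
    have h1 := card_filter_momentum_lt_le e Ls hL he hgen hρ
    calc (Fintype.card G : ℝ)⁻¹ * _
        ≤ (Fintype.card G : ℝ)⁻¹ * ∏ i, (2 * (Ls i : ℝ) * (2 ^ (j + 1) / Lr) + 1) := by gcongr
      _ ≤ ∏ i, (2 * (2 ^ (j + 1) / Lr) + 1 / (Ls i : ℝ)) := inv_card_mul_prod_le hLrs hcard hρ
      _ ≤ (3 * (2 ^ (j + 1) / Lr)) ^ 3 := by
          refine prod_two_mul_add_inv_le hLpos hLle ?_
          rw [div_le_div_iff_of_pos_right hLpos]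
          have : (1 : ℝ) ≤ 2 ^ (j + 1) := one_le_pow₀ (by norm_num)
          linarith
  have hY : (m * π ^ (2 * m + 2) / (4 * T ^ (2 * m)) : ℝ)
      = (Lr / T) ^ (2 * m) * (m * π ^ (2 * m + 2) / (4 * Lr ^ (2 * m))) := by
    have hL2m : Lr ^ (2 * m) ≠ 0 := pow_ne_zero _ hLpos.ne'
    have hT2m : T ^ (2 * m) ≠ 0 := pow_ne_zero _ hTpos.ne'
    rw [div_pow]; field_simp
  have hterm : ∀ j, (2 * π * 2 ^ (j + 1) / Lr) ^ k
        * (m * π ^ (2 * m + 2) / (4 * T ^ (2 * m)) * (Lr ^ 2 / (16 * c₀ * ((2 : ℝ) ^ j) ^ 2)) ^ (m + 1))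
        * ((Fintype.card G : ℝ)⁻¹ * ((Finset.univ.filter fun ψ : AddChar G ℂ =>
            ∀ i, |addCharMomentum (Ls i) (e i) ψ| < 2 ^ (j + 1) / Lr).card : ℝ))
      ≤ (Lr / T) ^ (2 * m) * (C₁ * (1 / 2) ^ j / Lr ^ (k + 1)) := by
    intro j
    have hB0 : 0 ≤ (2 * π * 2 ^ (j + 1) / Lr) ^ k
        * (m * π ^ (2 * m + 2) / (4 * T ^ (2 * m)) * (Lr ^ 2 / (16 * c₀ * ((2 : ℝ) ^ j) ^ 2)) ^ (m + 1)) := by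
      positivity
    calc _ ≤ (2 * π * 2 ^ (j + 1) / Lr) ^ k
          * (m * π ^ (2 * m + 2) / (4 * T ^ (2 * m)) * (Lr ^ 2 / (16 * c₀ * ((2 : ℝ) ^ j) ^ 2)) ^ (m + 1))
          * (3 * (2 ^ (j + 1) / Lr)) ^ 3 := mul_le_mul_of_nonneg_left (hcj j) hB0
      _ = (Lr / T) ^ (2 * m) * ((2 * π * 2 ^ (j + 1) / Lr) ^ k
          * (m * π ^ (2 * m + 2) / (4 * Lr ^ (2 * m)) * (Lr ^ 2 / (16 * c₀ * ((2 : ℝ) ^ j) ^ 2)) ^ (m + 1))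
          * (3 * (2 ^ (j + 1) / Lr)) ^ 3) := by rw [hY]; ring
      _ ≤ (Lr / T) ^ (2 * m) * (C₁ * (1 / 2) ^ j / Lr ^ (k + 1)) := by
          refine mul_le_mul_of_nonneg_left ?_ (by positivity)
          rw [hC₁]
          exact shellTerm_le hc₀ hLpos hkm j
  calc _ ≤ ∑ j ∈ Finset.range J, (Lr / T) ^ (2 * m) * (C₁ * (1 / 2) ^ j / Lr ^ (k + 1)) :=
        Finset.sum_le_sum fun j _ => hterm j
    _ = (Lr / T) ^ (2 * m) * C₁ / Lr ^ (k + 1) * ∑ j ∈ Finset.range J, (1 / 2 : ℝ) ^ j := by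
        rw [Finset.mul_sum]
        exact Finset.sum_congr rfl fun j _ => by ring
    _ ≤ (Lr / T) ^ (2 * m) * C₁ / Lr ^ (k + 1) * 2 :=
        mul_le_mul_of_nonneg_left (sum_geometric_two_le J) (by positivity)
    _ = 27 * m * (2 * π) ^ k * π ^ (2 * m + 2) * 2 ^ (k + 4) / (4 * (16 * c₀) ^ (m + 1))
        * (Lr / T) ^ (2 * m) / Lr ^ (k + 1) := by
        rw [hC₁, show (2 : ℝ) ^ (k + 4) = 2 ^ (k + 3) * 2 by ring]
        ring

/-- **Differences with a spatial step at every scale `2^N ≥ L`** (`L₀ = L₁ = L ≤ L₂`; a list `l` of `k` steps among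
`±e_i` containing one of `±e₀, ±e₁`; `k + 2 ≤ 2m`):
`|G|⁻¹ Σ_ψ (Π_{g∈l}‖ψ(g) − 1‖) σ_{C^{(m)}_N}(ψ) ≤ K₁ (L/2^N)^{2m}/L^{k+1}`,
`K₁ = 27m(2π)^kπ^{2m+2}2^{k+4}/(4(16c₀)^{m+1})`. [cite: Bauerschmidt2013, (1.10) (form)] -/
theorem avg_gradSymbol_frdPiecePow_le_offL_spatial
    (e : Fin 3 → G) (Ls : Fin 3 → ℕ) (hL : ∀ i, Ls i ≠ 0) (he : ∀ i, Ls i • e i = 0)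
    (hgen : ∀ ψ φ : AddChar G ℂ, (∀ i, ψ (e i) = φ (e i)) → ψ = φ)
    (hcard : ∏ i, (Ls i : ℝ) ≤ Fintype.card G) (hL01 : Ls 1 = Ls 0) (hLM : Ls 0 ≤ Ls 2)
    (hA : IsTranslationInvariant A) (hs : A.IsHermitian) (h0 : A.PosSemidef)
    (h4 : ((4 : ℝ) • (1 : _root_.Matrix G G ℝ) - A).PosSemidef)
    {c₀ : ℝ} (hc₀ : 0 < c₀)
    (hcoer : ∀ ψ : AddChar G ℂ, c₀ * ∑ i, (2 - 2 * (ψ (e i)).re) ≤ (symbol A ψ).re)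
    (m N : ℕ) (l : List G) (hl : ∀ g ∈ l, ∃ i, g = e i ∨ g = -e i)
    (hspat : ∃ g ∈ l, g = e 0 ∨ g = -e 0 ∨ g = e 1 ∨ g = -e 1) (hkm : l.length + 2 ≤ 2 * m) :
    (Fintype.card G : ℝ)⁻¹ * ∑ ψ : AddChar G ℂ,
        (l.map fun g => ‖ψ g - 1‖).prod * (symbol (frdPiecePow A m N) ψ).re
      ≤ 27 * m * (2 * π) ^ l.length * π ^ (2 * m + 2) * 2 ^ (l.length + 4) / (4 * (16 * c₀) ^ (m + 1))
          * ((Ls 0 : ℝ) / 2 ^ N) ^ (2 * m) / (Ls 0 : ℝ) ^ (l.length + 1) := by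
  classical
  set k := l.length with hk
  set J := Nat.log 2 (Ls 0) + 1 with hJ
  set B : ℕ → ℝ := fun j => (2 * π * 2 ^ (j + 1) / (Ls 0 : ℝ)) ^ k
      * (m * π ^ (2 * m + 2) / (4 * ((2 : ℝ) ^ N) ^ (2 * m))
        * (((Ls 0 : ℝ)) ^ 2 / (16 * c₀ * ((2 : ℝ) ^ j) ^ 2)) ^ (m + 1)) with hB
  set cnt : ℕ → ℝ := fun j => ((Finset.univ.filter fun ψ : AddChar G ℂ =>
      ∀ i, |addCharMomentum (Ls i) (e i) ψ| < 2 ^ (j + 1) / (Ls 0 : ℝ)).card : ℝ) with hcnt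
  have hB0 : ∀ j, 0 ≤ B j := fun j => by rw [hB]; positivity
  have hpt : ∀ ψ : AddChar G ℂ, (l.map fun g => ‖ψ g - 1‖).prod * (symbol (frdPiecePow A m N) ψ).re
      ≤ ∑ j ∈ Finset.range J, B j
        * (if ∀ i, |addCharMomentum (Ls i) (e i) ψ| < 2 ^ (j + 1) / (Ls 0 : ℝ) then (1 : ℝ) else 0) := by
    intro ψ
    by_cases hZ : addCharIndex (Ls 0) (e 0) ψ = 0 ∧ addCharIndex (Ls 1) (e 1) ψ = 0
    · rw [prod_norm_addChar_sub_one_eq_zero_of_spatial e Ls hL he ψ hZ l hspat, zero_mul]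
      exact Finset.sum_nonneg fun j _ => mul_nonneg (hB0 j) (by split_ifs <;> norm_num)
    · have hψ : addCharIndex (Ls 0) (e 0) ψ ≠ 0 ∨ addCharIndex (Ls 1) (e 1) ψ ≠ 0 := by tauto
      exact gradSymbol_frdPiecePow_le_shells_offZero e Ls hL he hL01 hA hs h0 h4 hc₀ hcoer m N ψ hψ l hl
  have hsum : ∑ ψ : AddChar G ℂ, (l.map fun g => ‖ψ g - 1‖).prod * (symbol (frdPiecePow A m N) ψ).re
      ≤ ∑ j ∈ Finset.range J, B j * cnt j := by
    refine (Finset.sum_le_sum fun ψ _ => hpt ψ).trans (le_of_eq ?_)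
    rw [Finset.sum_comm]
    refine Finset.sum_congr rfl fun j _ => ?_
    rw [← Finset.mul_sum, Finset.sum_boole]
  calc (Fintype.card G : ℝ)⁻¹ * ∑ ψ : AddChar G ℂ,
          (l.map fun g => ‖ψ g - 1‖).prod * (symbol (frdPiecePow A m N) ψ).re
      ≤ (Fintype.card G : ℝ)⁻¹ * ∑ j ∈ Finset.range J, B j * cnt j := by gcongr
    _ = ∑ j ∈ Finset.range J, B j * ((Fintype.card G : ℝ)⁻¹ * cnt j) := by
        rw [Finset.mul_sum]; exact Finset.sum_congr rfl fun j _ => by ring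
    _ ≤ _ := offZero_shellSum_le' e Ls hL he hgen hcard hL01 hLM hc₀ hkm N J

/-- Kernel form of `avg_gradSymbol_frdPiecePow_le_offL_spatial`:
`|∇_l C^{(m)}_N(x,y)| ≤ K₁ (L/2^N)^{2m}/L^{k+1}` for every scale `2^N ≥ L` and every `l` with a spatial step.
[cite: Bauerschmidt2013, (1.10) (form)] -/
theorem abs_rowDiffs_frdPiecePow_apply_le_offL_spatial
    (e : Fin 3 → G) (Ls : Fin 3 → ℕ) (hL : ∀ i, Ls i ≠ 0) (he : ∀ i, Ls i • e i = 0)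
    (hgen : ∀ ψ φ : AddChar G ℂ, (∀ i, ψ (e i) = φ (e i)) → ψ = φ)
    (hcard : ∏ i, (Ls i : ℝ) ≤ Fintype.card G) (hL01 : Ls 1 = Ls 0) (hLM : Ls 0 ≤ Ls 2)
    (hA : IsTranslationInvariant A) (hs : A.IsHermitian) (h0 : A.PosSemidef)
    (h4 : ((4 : ℝ) • (1 : _root_.Matrix G G ℝ) - A).PosSemidef)
    {c₀ : ℝ} (hc₀ : 0 < c₀)
    (hcoer : ∀ ψ : AddChar G ℂ, c₀ * ∑ i, (2 - 2 * (ψ (e i)).re) ≤ (symbol A ψ).re)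
    (m N : ℕ) (l : List G) (hl : ∀ g ∈ l, ∃ i, g = e i ∨ g = -e i)
    (hspat : ∃ g ∈ l, g = e 0 ∨ g = -e 0 ∨ g = e 1 ∨ g = -e 1) (hkm : l.length + 2 ≤ 2 * m) (x y : G) :
    |rowDiffs l (frdPiecePow A m N) x y|
      ≤ 27 * m * (2 * π) ^ l.length * π ^ (2 * m + 2) * 2 ^ (l.length + 4) / (4 * (16 * c₀) ^ (m + 1))
          * ((Ls 0 : ℝ) / 2 ^ N) ^ (2 * m) / (Ls 0 : ℝ) ^ (l.length + 1) :=
  (abs_rowDiffs_frdPiecePow_apply_le hA hs h0 h4 m N l x y).trans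
    (avg_gradSymbol_frdPiecePow_le_offL_spatial e Ls hL he hgen hcard hL01 hLM hA hs h0 h4 hc₀ hcoer m N l hl
      hspat hkm)

omit [DecidableEq G] [Fintype G] in
/-- A character with all three indices zero is trivial (when characters are determined by the `e_i`). [folklore] -/
theorem eq_one_of_index_eq_zero (e : Fin 3 → G) (Ls : Fin 3 → ℕ) (hL : ∀ i, Ls i ≠ 0) (he : ∀ i, Ls i • e i = 0)
    (hgen : ∀ ψ φ : AddChar G ℂ, (∀ i, ψ (e i) = φ (e i)) → ψ = φ) (ψ : AddChar G ℂ)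
    (h : ∀ i, addCharIndex (Ls i) (e i) ψ = 0) : ψ = 1 :=
  hgen ψ 1 fun i => by rw [addChar_apply_eq_one_of_index_eq_zero (hL i) (he i) ψ (h i), AddChar.one_apply]

omit [DecidableEq G] in
/-- For a nonempty list of steps `±e₂` the gradient factor of a character with `ψ(e₂) = 1` vanishes. [folklore] -/
theorem prod_norm_addChar_sub_one_eq_zero_of_temporal (e : Fin 3 → G) (ψ : AddChar G ℂ) (h2 : ψ (e 2) = 1)
    (l : List G) (hl : l ≠ []) (htemp : ∀ g ∈ l, g = e 2 ∨ g = -e 2) :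
    (l.map fun g => ‖ψ g - 1‖).prod = 0 := by
  obtain ⟨g, hg⟩ := List.exists_mem_of_ne_nil l hl
  have hzero : ‖ψ g - 1‖ = 0 := by
    rcases htemp g hg with rfl | rfl
    · simp [h2]
    · rw [norm_addChar_neg_sub_one]; simp [h2]
  exact List.prod_eq_zero (List.mem_map.2 ⟨g, hg, hzero⟩)

/-- **Purely temporal differences at scales beyond the temporal period.**  In the regime `L₀ = L₁ = L ≤ L₂ = M ≤ 2^N`,
for a NONEMPTY list `l` of `k` steps among `±e₂` with `k + 2 ≤ 2m`:
`|G|⁻¹ Σ_ψ (Π_{g∈l}‖ψ(g) − 1‖) σ_{C^{(m)}_N}(ψ) ≤ K₁ ((L/2^N)^{2m}/L^{k+1} + M²/((2^N)^{k+1} L²))`,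
`K₁ = 27m(2π)^kπ^{2m+2}2^{k+4}/(4(16c₀)^{m+1})` — only the dyadic shells `2^{j+1}/2^N > 1/M` contain non-trivial
characters. [cite: Bauerschmidt2013, (1.10) (form)] -/
theorem avg_gradSymbol_frdPiecePow_le_beyond_temporal
    (e : Fin 3 → G) (Ls : Fin 3 → ℕ) (hL : ∀ i, Ls i ≠ 0) (he : ∀ i, Ls i • e i = 0)
    (hgen : ∀ ψ φ : AddChar G ℂ, (∀ i, ψ (e i) = φ (e i)) → ψ = φ)
    (hcard : ∏ i, (Ls i : ℝ) ≤ Fintype.card G) (hL01 : Ls 1 = Ls 0) (hLM : Ls 0 ≤ Ls 2)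
    (hA : IsTranslationInvariant A) (hs : A.IsHermitian) (h0 : A.PosSemidef)
    (h4 : ((4 : ℝ) • (1 : _root_.Matrix G G ℝ) - A).PosSemidef)
    {c₀ : ℝ} (hc₀ : 0 < c₀)
    (hcoer : ∀ ψ : AddChar G ℂ, c₀ * ∑ i, (2 - 2 * (ψ (e i)).re) ≤ (symbol A ψ).re)
    (m N : ℕ) (hMT : Ls 2 ≤ 2 ^ N)
    (l : List G) (hl1 : l ≠ []) (htemp : ∀ g ∈ l, g = e 2 ∨ g = -e 2) (hkm : l.length + 2 ≤ 2 * m) :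
    (Fintype.card G : ℝ)⁻¹ * ∑ ψ : AddChar G ℂ,
        (l.map fun g => ‖ψ g - 1‖).prod * (symbol (frdPiecePow A m N) ψ).re
      ≤ 27 * m * (2 * π) ^ l.length * π ^ (2 * m + 2) * 2 ^ (l.length + 4) / (4 * (16 * c₀) ^ (m + 1))
          * (((Ls 0 : ℝ) / 2 ^ N) ^ (2 * m) / (Ls 0 : ℝ) ^ (l.length + 1)
              + (Ls 2 : ℝ) ^ 2 / (((2 : ℝ) ^ N) ^ (l.length + 1) * (Ls 0 : ℝ) ^ 2)) := by
  classical
  set k := l.length with hk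
  set Mr : ℝ := (Ls 2 : ℝ) with hMr
  have hLpos : (0 : ℝ) < (Ls 0 : ℝ) := Nat.cast_pos.mpr (Nat.pos_of_ne_zero (hL 0))
  have hMpos : (0 : ℝ) < Mr := Nat.cast_pos.mpr (Nat.pos_of_ne_zero (hL 2))
  have hTpos : (0 : ℝ) < (2 : ℝ) ^ N := by positivity
  have hMT' : Mr ≤ (2 : ℝ) ^ N := by rw [hMr]; exact_mod_cast hMT
  have hl : ∀ g ∈ l, ∃ i, g = e i ∨ g = -e i := fun g hg => ⟨2, htemp g hg⟩
  set J := Nat.log 2 (Ls 0) + 1 with hJ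
  set Bn : ℕ → ℝ := fun j => (2 * π * 2 ^ (j + 1) / (Ls 0 : ℝ)) ^ k
      * (m * π ^ (2 * m + 2) / (4 * ((2 : ℝ) ^ N) ^ (2 * m))
        * (((Ls 0 : ℝ)) ^ 2 / (16 * c₀ * ((2 : ℝ) ^ j) ^ 2)) ^ (m + 1)) with hBn
  set Bz : ℕ → ℝ := fun j => (2 * π * 2 ^ (j + 1) / 2 ^ N) ^ k
      * (m * π ^ (2 * m + 2) / (4 * ((2 : ℝ) ^ N) ^ (2 * m))
        * (((2 : ℝ) ^ N) ^ 2 / (16 * c₀ * ((2 : ℝ) ^ j) ^ 2)) ^ (m + 1)) with hBz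
  set In : ℕ → AddChar G ℂ → Prop := fun j ψ =>
    ∀ i, |addCharMomentum (Ls i) (e i) ψ| < 2 ^ (j + 1) / (Ls 0 : ℝ) with hIn
  -- populated zero-mode shells only: the side condition `1/M < 2^{j+1}/2^N` is part of the indicator
  set Zs : ℕ → AddChar G ℂ → Prop := fun j ψ => addCharIndex (Ls 0) (e 0) ψ = 0 ∧
      addCharIndex (Ls 1) (e 1) ψ = 0 ∧ |addCharMomentum (Ls 2) (e 2) ψ| < 2 ^ (j + 1) / 2 ^ N with hZs
  set good : ℕ → Prop := fun j => 1 / Mr < 2 ^ (j + 1) / (2 : ℝ) ^ N with hgood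
  have hBn0 : ∀ j, 0 ≤ Bn j := fun j => by rw [hBn]; positivity
  have hBz0 : ∀ j, 0 ≤ Bz j := fun j => by rw [hBz]; positivity
  have hind0 : ∀ (p : Prop) [Decidable p], (0 : ℝ) ≤ if p then 1 else 0 := by
    intro p _; split_ifs <;> norm_num
  -- pointwise domination
  have hpt : ∀ ψ : AddChar G ℂ, (l.map fun g => ‖ψ g - 1‖).prod * (symbol (frdPiecePow A m N) ψ).re
      ≤ (∑ j ∈ Finset.range J, Bn j * (if In j ψ then (1 : ℝ) else 0))
        + ∑ j ∈ Finset.range N, Bz j * (if good j ∧ Zs j ψ then (1 : ℝ) else 0) := by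
    intro ψ
    have hn0 : 0 ≤ ∑ j ∈ Finset.range J, Bn j * (if In j ψ then (1 : ℝ) else 0) :=
      Finset.sum_nonneg fun j _ => mul_nonneg (hBn0 j) (hind0 _)
    have hz0 : 0 ≤ ∑ j ∈ Finset.range N, Bz j * (if good j ∧ Zs j ψ then (1 : ℝ) else 0) :=
      Finset.sum_nonneg fun j _ => mul_nonneg (hBz0 j) (hind0 _)
    by_cases hZ : addCharIndex (Ls 0) (e 0) ψ = 0 ∧ addCharIndex (Ls 1) (e 1) ψ = 0
    · by_cases h2 : addCharIndex (Ls 2) (e 2) ψ = 0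
      · -- the trivial character: the gradient factor vanishes
        have hψ1 : ψ = 1 := eq_one_of_index_eq_zero e Ls hL he hgen ψ fun i => by
          fin_cases i
          · exact hZ.1
          · exact hZ.2
          · exact h2
        have hP : (l.map fun g => ‖ψ g - 1‖).prod = 0 :=
          prod_norm_addChar_sub_one_eq_zero_of_temporal e ψ (by rw [hψ1]; rfl) l hl1 htemp
        rw [hP, zero_mul]
        exact add_nonneg hn0 hz0
      · -- a non-trivial zero-mode character: temporal momentum at least `1/M ≥ 1/2^N`
        have ht2 : 1 / Mr ≤ |addCharMomentum (Ls 2) (e 2) ψ| :=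
          inv_le_abs_addCharMomentum_of_index_ne_zero (hL 2) ψ h2
        have h := gradSymbol_frdPiecePow_le_shells_zeroMode e Ls hL he hA hs h0 h4 hc₀ hcoer m N ψ hZ l htemp
        have hcube : ¬ (|addCharMomentum (Ls 2) (e 2) ψ| < 1 / 2 ^ N) := by
          intro hlt
          have : 1 / (2 : ℝ) ^ N ≤ 1 / Mr := one_div_le_one_div_of_le hMpos hMT'
          linarith
        rw [if_neg hcube, mul_zero, zero_add] at h
        refine h.trans ?_
        refine le_add_of_nonneg_of_le hn0 (Finset.sum_le_sum fun j _ => ?_)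
        refine mul_le_mul_of_nonneg_left ?_ (hBz0 j)
        by_cases hj : |addCharMomentum (Ls 2) (e 2) ψ| < 2 ^ (j + 1) / 2 ^ N
        · have hg : good j := lt_of_le_of_lt ht2 hj
          rw [if_pos hj, if_pos ⟨hg, hZ.1, hZ.2, hj⟩]
        · rw [if_neg hj]; exact hind0 _
    · have hψ : addCharIndex (Ls 0) (e 0) ψ ≠ 0 ∨ addCharIndex (Ls 1) (e 1) ψ ≠ 0 := by tauto
      have h := gradSymbol_frdPiecePow_le_shells_offZero e Ls hL he hL01 hA hs h0 h4 hc₀ hcoer m N ψ hψ l hl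
      rw [hBn, hIn] at *
      linarith
  -- sum over `ψ`
  set cn : ℕ → ℝ := fun j => ((Finset.univ.filter fun ψ : AddChar G ℂ => In j ψ).card : ℝ) with hcn
  set cz : ℕ → ℝ := fun j => ((Finset.univ.filter fun ψ : AddChar G ℂ => good j ∧ Zs j ψ).card : ℝ) with hcz
  have hsumA : ∑ ψ : AddChar G ℂ, ∑ j ∈ Finset.range J, Bn j * (if In j ψ then (1 : ℝ) else 0)
      = ∑ j ∈ Finset.range J, Bn j * cn j := by
    rw [Finset.sum_comm]
    refine Finset.sum_congr rfl fun j _ => ?_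
    rw [← Finset.mul_sum, Finset.sum_boole]
  have hsumC : ∑ ψ : AddChar G ℂ, ∑ j ∈ Finset.range N, Bz j * (if good j ∧ Zs j ψ then (1 : ℝ) else 0)
      = ∑ j ∈ Finset.range N, Bz j * cz j := by
    rw [Finset.sum_comm]
    refine Finset.sum_congr rfl fun j _ => ?_
    rw [← Finset.mul_sum, Finset.sum_boole]
  have hsum : ∑ ψ : AddChar G ℂ, (l.map fun g => ‖ψ g - 1‖).prod * (symbol (frdPiecePow A m N) ψ).re
      ≤ (∑ j ∈ Finset.range J, Bn j * cn j) + ∑ j ∈ Finset.range N, Bz j * cz j := by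
    refine (Finset.sum_le_sum fun ψ _ => hpt ψ).trans (le_of_eq ?_)
    rw [Finset.sum_add_distrib, hsumA, hsumC]
  -- constants
  set C₁ : ℝ := 27 * m * (2 * π) ^ k * π ^ (2 * m + 2) * 2 ^ (k + 3) / (4 * (16 * c₀) ^ (m + 1)) with hC₁
  have hC₁0 : 0 ≤ C₁ := by rw [hC₁]; positivity
  set U : ℝ := (2 : ℝ) ^ N / (((2 : ℝ) ^ N) ^ k * (Ls 0 : ℝ) ^ 2) with hU
  have hU0 : 0 ≤ U := by rw [hU]; positivity
  -- (1) the off-zero family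
  have h1 : ∑ j ∈ Finset.range J, Bn j * ((Fintype.card G : ℝ)⁻¹ * cn j)
      ≤ 2 * C₁ * (((Ls 0 : ℝ) / 2 ^ N) ^ (2 * m) / (Ls 0 : ℝ) ^ (k + 1)) := by
    have h := offZero_shellSum_le' e Ls hL he hgen hcard hL01 hLM hc₀ hkm N J
    refine h.trans (le_of_eq ?_)
    rw [hC₁, show (2 : ℝ) ^ (k + 4) = 2 ^ (k + 3) * 2 by ring]; ring
  -- (2) the populated zero-mode shells: each carries the extra factor `(1/4)^j < 4M²/4^N`
  have h3 : ∑ j ∈ Finset.range N, Bz j * ((Fintype.card G : ℝ)⁻¹ * cz j) ≤ 2 * C₁ * (U * (Mr ^ 2 / ((2 : ℝ) ^ N) ^ 2)) := by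
    have hterm : ∀ j, Bz j * ((Fintype.card G : ℝ)⁻¹ * cz j) ≤ C₁ * (1 / 2) ^ j * (U * (Mr ^ 2 / ((2 : ℝ) ^ N) ^ 2)) := by
      intro j
      by_cases hg : good j
      · -- populated shell: count by the zero-mode window lemma
        have hsub : (Finset.univ.filter fun ψ : AddChar G ℂ => good j ∧ Zs j ψ)
            ⊆ (Finset.univ.filter fun ψ : AddChar G ℂ => addCharIndex (Ls 0) (e 0) ψ = 0 ∧
              addCharIndex (Ls 1) (e 1) ψ = 0 ∧ |addCharMomentum (Ls 2) (e 2) ψ| < 2 ^ (j + 1) / (2 : ℝ) ^ N) := by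
          intro ψ hψ
          simp only [Finset.mem_filter, Finset.mem_univ, true_and, hZs] at hψ ⊢
          exact hψ.2
        have hcz_le : cz j ≤ ((Finset.univ.filter fun ψ : AddChar G ℂ => addCharIndex (Ls 0) (e 0) ψ = 0 ∧
            addCharIndex (Ls 1) (e 1) ψ = 0 ∧ |addCharMomentum (Ls 2) (e 2) ψ| < 2 ^ (j + 1) / (2 : ℝ) ^ N).card : ℝ) := by
          show ((Finset.univ.filter fun ψ : AddChar G ℂ => good j ∧ Zs j ψ).card : ℝ) ≤ _
          exact_mod_cast Finset.card_le_card hsub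
        have hρ : 1 / (Ls 2 : ℝ) ≤ 2 ^ (j + 1) / (2 : ℝ) ^ N := le_of_lt hg
        have hc := inv_card_mul_card_zeroMode_le e Ls hL he hgen hcard hL01 hρ
        have hshell := shellTerm_le hc₀ hTpos hkm j
        have hsplit : (27 * (2 ^ (j + 1) / (2 : ℝ) ^ N) / (Ls 0 : ℝ) ^ 2 : ℝ)
            = (3 * (2 ^ (j + 1) / (2 : ℝ) ^ N)) ^ 3 * (((2 : ℝ) ^ N) ^ 2 / ((Ls 0 : ℝ) ^ 2 * 4 ^ (j + 1))) := by
          have h4' : (4 : ℝ) ^ (j + 1) = 2 ^ (j + 1) * 2 ^ (j + 1) := by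
            rw [show (4 : ℝ) = 2 * 2 by norm_num, mul_pow]
          have h2j : (2 : ℝ) ^ (j + 1) ≠ 0 := pow_ne_zero _ two_ne_zero
          have hL2 : (Ls 0 : ℝ) ^ 2 ≠ 0 := pow_ne_zero _ hLpos.ne'
          have hT0 : (2 : ℝ) ^ N ≠ 0 := hTpos.ne'
          rw [h4']
          field_simp
          ring
        -- the shell factor `(1/4)^j ≤ 4 M²/4^N` on populated shells
        have hquarter : (1 / 4 : ℝ) ^ j ≤ 4 * (Mr ^ 2 / ((2 : ℝ) ^ N) ^ 2) := by
          have hg' : (2 : ℝ) ^ N < Mr * 2 ^ (j + 1) := by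
            have := hg
            rw [hgood, div_lt_div_iff₀ hMpos hTpos, one_mul] at this
            linarith
          have hsq : ((2 : ℝ) ^ N) ^ 2 < (Mr * 2 ^ (j + 1)) ^ 2 := by gcongr
          have e4 : ((2 : ℝ) ^ (j + 1)) ^ 2 = 4 * 4 ^ j := by
            rw [← pow_mul, mul_comm, pow_mul, show (2 : ℝ) ^ 2 = 4 by norm_num, pow_succ, mul_comm]
          have key : ((2 : ℝ) ^ N) ^ 2 < 4 * 4 ^ j * Mr ^ 2 := by
            calc ((2 : ℝ) ^ N) ^ 2 < (Mr * 2 ^ (j + 1)) ^ 2 := hsq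
              _ = 4 * 4 ^ j * Mr ^ 2 := by rw [mul_pow, e4]; ring
          have h4pos : (0 : ℝ) < 4 ^ j := by positivity
          rw [one_div_pow, div_le_iff₀ h4pos,
            show 4 * (Mr ^ 2 / ((2 : ℝ) ^ N) ^ 2) * 4 ^ j = (4 * 4 ^ j * Mr ^ 2) / ((2 : ℝ) ^ N) ^ 2 by ring,
            le_div_iff₀ (by positivity), one_mul]
          exact key.le
        calc Bz j * ((Fintype.card G : ℝ)⁻¹ * cz j)
            ≤ Bz j * ((Fintype.card G : ℝ)⁻¹ * ((Finset.univ.filter fun ψ : AddChar G ℂ =>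
                addCharIndex (Ls 0) (e 0) ψ = 0 ∧ addCharIndex (Ls 1) (e 1) ψ = 0 ∧
                  |addCharMomentum (Ls 2) (e 2) ψ| < 2 ^ (j + 1) / (2 : ℝ) ^ N).card : ℝ)) :=
              mul_le_mul_of_nonneg_left (mul_le_mul_of_nonneg_left hcz_le (inv_nonneg.2 (Nat.cast_nonneg _)))
                (hBz0 j)
          _ ≤ Bz j * (27 * (2 ^ (j + 1) / (2 : ℝ) ^ N) / (Ls 0 : ℝ) ^ 2) := mul_le_mul_of_nonneg_left hc (hBz0 j)
          _ = (Bz j * (3 * (2 ^ (j + 1) / (2 : ℝ) ^ N)) ^ 3)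
                * (((2 : ℝ) ^ N) ^ 2 / ((Ls 0 : ℝ) ^ 2 * 4 ^ (j + 1))) := by rw [hsplit]; ring
          _ ≤ (C₁ * (1 / 2) ^ j / ((2 : ℝ) ^ N) ^ (k + 1))
                * (((2 : ℝ) ^ N) ^ 2 / ((Ls 0 : ℝ) ^ 2 * 4 ^ (j + 1))) := by
              refine mul_le_mul_of_nonneg_right ?_ (by positivity)
              rw [hBz, hC₁]; exact hshell
          _ = C₁ / 4 * (1 / 2) ^ j * U * (1 / 4) ^ j := by
              have hTk : ((2 : ℝ) ^ N) ^ k ≠ 0 := pow_ne_zero _ hTpos.ne'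
              have hT0 : (2 : ℝ) ^ N ≠ 0 := hTpos.ne'
              have h4j : (4 : ℝ) ^ j ≠ 0 := pow_ne_zero _ (by norm_num)
              have hL2 : (Ls 0 : ℝ) ^ 2 ≠ 0 := pow_ne_zero _ hLpos.ne'
              rw [hU, show ((2 : ℝ) ^ N) ^ (k + 1) = ((2 : ℝ) ^ N) ^ k * 2 ^ N by ring,
                show (4 : ℝ) ^ (j + 1) = 4 ^ j * 4 by ring, one_div_pow, one_div_pow]
              field_simp
          _ ≤ C₁ / 4 * (1 / 2) ^ j * U * (4 * (Mr ^ 2 / ((2 : ℝ) ^ N) ^ 2)) :=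
              mul_le_mul_of_nonneg_left hquarter (by positivity)
          _ = C₁ * (1 / 2) ^ j * (U * (Mr ^ 2 / ((2 : ℝ) ^ N) ^ 2)) := by ring
      · -- empty shell
        have hempty : (Finset.univ.filter fun ψ : AddChar G ℂ => good j ∧ Zs j ψ) = ∅ :=
          Finset.filter_eq_empty_iff.2 fun ψ _ h => hg h.1
        have hcz0 : cz j = 0 := by
          show ((Finset.univ.filter fun ψ : AddChar G ℂ => good j ∧ Zs j ψ).card : ℝ) = 0
          rw [hempty, Finset.card_empty, Nat.cast_zero]
        rw [hcz0, mul_zero, mul_zero]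
        positivity
    calc ∑ j ∈ Finset.range N, Bz j * ((Fintype.card G : ℝ)⁻¹ * cz j)
        ≤ ∑ j ∈ Finset.range N, C₁ * (1 / 2) ^ j * (U * (Mr ^ 2 / ((2 : ℝ) ^ N) ^ 2)) :=
          Finset.sum_le_sum fun j _ => hterm j
      _ = C₁ * (U * (Mr ^ 2 / ((2 : ℝ) ^ N) ^ 2)) * ∑ j ∈ Finset.range N, (1 / 2 : ℝ) ^ j := by
          rw [Finset.mul_sum]; exact Finset.sum_congr rfl fun j _ => by ring
      _ ≤ C₁ * (U * (Mr ^ 2 / ((2 : ℝ) ^ N) ^ 2)) * 2 :=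
          mul_le_mul_of_nonneg_left (sum_geometric_two_le N) (by positivity)
      _ = 2 * C₁ * (U * (Mr ^ 2 / ((2 : ℝ) ^ N) ^ 2)) := by ring
  -- assemble
  have hUM : U * (Mr ^ 2 / ((2 : ℝ) ^ N) ^ 2) = Mr ^ 2 / (((2 : ℝ) ^ N) ^ (k + 1) * (Ls 0 : ℝ) ^ 2) := by
    have hTk : ((2 : ℝ) ^ N) ^ k ≠ 0 := pow_ne_zero _ hTpos.ne'
    have hT0 : (2 : ℝ) ^ N ≠ 0 := hTpos.ne'
    have hL2 : (Ls 0 : ℝ) ^ 2 ≠ 0 := pow_ne_zero _ hLpos.ne'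
    rw [hU]
    field_simp
    ring
  calc (Fintype.card G : ℝ)⁻¹ * ∑ ψ : AddChar G ℂ,
          (l.map fun g => ‖ψ g - 1‖).prod * (symbol (frdPiecePow A m N) ψ).re
      ≤ (Fintype.card G : ℝ)⁻¹ * ((∑ j ∈ Finset.range J, Bn j * cn j) + ∑ j ∈ Finset.range N, Bz j * cz j) := by
        gcongr
    _ = (∑ j ∈ Finset.range J, Bn j * ((Fintype.card G : ℝ)⁻¹ * cn j))
          + ∑ j ∈ Finset.range N, Bz j * ((Fintype.card G : ℝ)⁻¹ * cz j) := by
        rw [mul_add, Finset.mul_sum, Finset.mul_sum]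
        congr 1
        · exact Finset.sum_congr rfl fun j _ => by ring
        · exact Finset.sum_congr rfl fun j _ => by ring
    _ ≤ 2 * C₁ * (((Ls 0 : ℝ) / 2 ^ N) ^ (2 * m) / (Ls 0 : ℝ) ^ (k + 1)) + 2 * C₁ * (U * (Mr ^ 2 / ((2 : ℝ) ^ N) ^ 2)) :=
        add_le_add h1 h3
    _ = 27 * m * (2 * π) ^ k * π ^ (2 * m + 2) * 2 ^ (k + 4) / (4 * (16 * c₀) ^ (m + 1))
          * (((Ls 0 : ℝ) / 2 ^ N) ^ (2 * m) / (Ls 0 : ℝ) ^ (k + 1)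
              + Mr ^ 2 / (((2 : ℝ) ^ N) ^ (k + 1) * (Ls 0 : ℝ) ^ 2)) := by
        rw [hUM, hC₁, show (2 : ℝ) ^ (k + 4) = 2 ^ (k + 3) * 2 by ring]
        ring

/-- Kernel form of `avg_gradSymbol_frdPiecePow_le_beyond_temporal`: for `M ≤ 2^N` and a nonempty list of temporal steps,
`|∇_l C^{(m)}_N(x,y)| ≤ K₁ ((L/2^N)^{2m}/L^{k+1} + M²/((2^N)^{k+1}L²))`. [cite: Bauerschmidt2013, (1.10) (form)] -/
theorem abs_rowDiffs_frdPiecePow_apply_le_beyond_temporal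
    (e : Fin 3 → G) (Ls : Fin 3 → ℕ) (hL : ∀ i, Ls i ≠ 0) (he : ∀ i, Ls i • e i = 0)
    (hgen : ∀ ψ φ : AddChar G ℂ, (∀ i, ψ (e i) = φ (e i)) → ψ = φ)
    (hcard : ∏ i, (Ls i : ℝ) ≤ Fintype.card G) (hL01 : Ls 1 = Ls 0) (hLM : Ls 0 ≤ Ls 2)
    (hA : IsTranslationInvariant A) (hs : A.IsHermitian) (h0 : A.PosSemidef)
    (h4 : ((4 : ℝ) • (1 : _root_.Matrix G G ℝ) - A).PosSemidef)
    {c₀ : ℝ} (hc₀ : 0 < c₀)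
    (hcoer : ∀ ψ : AddChar G ℂ, c₀ * ∑ i, (2 - 2 * (ψ (e i)).re) ≤ (symbol A ψ).re)
    (m N : ℕ) (hMT : Ls 2 ≤ 2 ^ N)
    (l : List G) (hl1 : l ≠ []) (htemp : ∀ g ∈ l, g = e 2 ∨ g = -e 2) (hkm : l.length + 2 ≤ 2 * m) (x y : G) :
    |rowDiffs l (frdPiecePow A m N) x y|
      ≤ 27 * m * (2 * π) ^ l.length * π ^ (2 * m + 2) * 2 ^ (l.length + 4) / (4 * (16 * c₀) ^ (m + 1))
          * (((Ls 0 : ℝ) / 2 ^ N) ^ (2 * m) / (Ls 0 : ℝ) ^ (l.length + 1)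
              + (Ls 2 : ℝ) ^ 2 / (((2 : ℝ) ^ N) ^ (l.length + 1) * (Ls 0 : ℝ) ^ 2)) :=
  (abs_rowDiffs_frdPiecePow_apply_le hA hs h0 h4 m N l x y).trans
    (avg_gradSymbol_frdPiecePow_le_beyond_temporal e Ls hL he hgen hcard hL01 hLM hA hs h0 h4 hc₀ hcoer m N hMT l
      hl1 htemp hkm)

end Beyond

end Literature.Analysis.Matrix

end
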